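import Summits.Ventures.WeilGRH.TwistedGramOddComplex
import HarnessLib

/-!
# GRH arm (rh-explicit, venture WeilGRH): realification of the hermitian Gram certificates (the «J-real form»)

Cell `rh-explicit`, WEIL TRACK — GRH ARM (typing seat weil-grh-1).  The entry theorems of
`TwistedGramEvenComplex.lean` / `TwistedGramOddComplex.lean` conclude from `0 ≤ Σ_{n,m} Re(conj c_n · c_m · G(n,m))`
for all complex `c`; a kernel-side certificate decides a REAL quadratic form.  Writing `c = x + iy`,

  `Σ_{n,m} Re(conj c_n c_m G(n,m)) = Σ_{n,m} [x_n x_m Re G + y_n y_m Re G − x_n y_m Im G + y_n x_m Im G](n,m)`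

(`re_sum_sum_conj_mul_mul_eq_realify`) — the real quadratic form of the `2|s| × 2|s|` matrix `[[Re G, −Im G],[Im G, Re G]]`
(the cell's «J-real `(2N+1)`-form», EXTREMALS/GRH/Kt-closure-v14-complex-CERT).  Hence
`weilPositivityOnChar_of_twistedGramCoeffC_realify` / `…OddC_realify`: non-negativity of that real form for every `N`
and all real `x, y` gives the rung for a complex character of either parity.  No definitions; no named facts.
-/

set_option autoImplicit false

noncomputable section

open Complex Finset
open scoped Real ComplexConjugate

namespace Summit.Ventures.WeilGRH

open Literature.NumberTheory.LFunctions
open Literature.NumberTheory.LFunctions.Yoshida1992 (modes chi)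

variable {q : ℕ} {a : ℝ}

/-- **Realification of a hermitian pairing**: with `x = Re c`, `y = Im c`,
`Σ_{n,m} Re(conj c_n c_m G(n,m)) = Σ_{n,m} (x_n x_m Re G(n,m) + y_n y_m Re G(n,m) − x_n y_m Im G(n,m) + y_n x_m Im G(n,m))`
(no hypothesis on `G`). -/
theorem re_sum_sum_conj_mul_mul_eq_realify (s : Finset ℤ) (G : ℤ → ℤ → ℂ) (c : ℤ → ℂ) :
    ∑ n ∈ s, ∑ m ∈ s, (conj (c n) * c m * G n m).re =
      ∑ n ∈ s, ∑ m ∈ s, ((c n).re * (c m).re * (G n m).re + (c n).im * (c m).im * (G n m).re -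
        (c n).re * (c m).im * (G n m).im + (c n).im * (c m).re * (G n m).im) := by
  refine Finset.sum_congr rfl fun n _ ↦ Finset.sum_congr rfl fun m _ ↦ ?_
  simp only [Complex.mul_re, Complex.mul_im, Complex.conj_re, Complex.conj_im]
  ring

/-- **Real certificates of the realified form suffice**: if the real quadratic form of `[[Re G, −Im G],[Im G, Re G]]`
is non-negative on all real `(x, y)`, then the hermitian pairing of `G` is non-negative on every complex `c`. -/
theorem re_sum_sum_conj_mul_mul_nonneg_of_realify (s : Finset ℤ) (G : ℤ → ℤ → ℂ)
    (h : ∀ x y : ℤ → ℝ, 0 ≤ ∑ n ∈ s, ∑ m ∈ s, (x n * x m * (G n m).re + y n * y m * (G n m).re -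
      x n * y m * (G n m).im + y n * x m * (G n m).im)) (c : ℤ → ℂ) :
    0 ≤ ∑ n ∈ s, ∑ m ∈ s, (conj (c n) * c m * G n m).re := by
  rw [re_sum_sum_conj_mul_mul_eq_realify]
  exact h (fun n ↦ (c n).re) (fun n ↦ (c n).im)

/-- **Even complex character: the realified certificate gives the rung** (`q ≠ 1`, `a > 0`, `a_χ = 0`). -/
theorem weilPositivityOnChar_of_twistedGramCoeffC_realify (hq : q ≠ 1) (χ : DirichletCharacter ℂ q)
    (heven : charParity χ = 0) (ha : 0 < a)
    (h : ∀ (N : ℕ) (x y : ℤ → ℝ), 0 ≤ ∑ n ∈ modes N, ∑ m ∈ modes N,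
      (x n * x m * (twistedGramCoeffC χ a n m).re + y n * y m * (twistedGramCoeffC χ a n m).re -
        x n * y m * (twistedGramCoeffC χ a n m).im + y n * x m * (twistedGramCoeffC χ a n m).im)) :
    WeilPositivityOnChar χ a :=
  weilPositivityOnChar_of_twistedGramCoeffC_psd hq χ heven ha fun N c ↦
    re_sum_sum_conj_mul_mul_nonneg_of_realify (modes N) _ (h N) c

/-- **Odd complex character: the realified certificate gives the rung** (`q ≠ 1`, `a > 0`, `a_χ = 1`). -/
theorem weilPositivityOnChar_of_twistedGramCoeffOddC_realify (hq : q ≠ 1) (χ : DirichletCharacter ℂ q)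
    (hodd : charParity χ = 1) (ha : 0 < a)
    (h : ∀ (N : ℕ) (x y : ℤ → ℝ), 0 ≤ ∑ n ∈ modes N, ∑ m ∈ modes N,
      (x n * x m * (twistedGramCoeffOddC χ a n m).re + y n * y m * (twistedGramCoeffOddC χ a n m).re -
        x n * y m * (twistedGramCoeffOddC χ a n m).im + y n * x m * (twistedGramCoeffOddC χ a n m).im)) :
    WeilPositivityOnChar χ a :=
  weilPositivityOnChar_of_twistedGramCoeffOddC_psd hq χ hodd ha fun N c ↦
    re_sum_sum_conj_mul_mul_nonneg_of_realify (modes N) _ (h N) c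

end Summit.Ventures.WeilGRH

end
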